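import Summits.BirchSwinnertonDyer.BirchSwinnertonDyer.Theorems.KimAtThreeCyclotomicSigmaFrobenius
import HarnessLib

/-!
# Transport of the twisted lattice `P_w^loc · 𝒪_𝔓` between the places above `p` of `ℚ(ζ_m)`

Cell `bsd-addord`, seat `bsd-addord-w2-acc3` (PROGRAMME PART 1b row (3), gen 8); `--supports
stmt-BirchSwinnertonDyer-19679` (helper). TOOL theorems only (no definition, no instance, no named fact, no
`sorry`); pure algebra of `ℚ(ζ_m)` and its completions; closes nothing; nothing booked; BSD / 19679 / 20397 are
not proved by any of this.

WHY. The twisted per-factor `exp*` bound of the good-anomalous rows (`KimAtThreeCyclotomicTwistedExpStarBound`,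
`…Values`: `p · x ∈ P_w^loc · 𝒪_{𝔓₀}`, `P_w^loc = p − a·(σ_w)_{𝔓₀} + (σ_w)_{𝔓₀}²`) is produced at the place `𝔓₀`
where the dual-exponential line datum lives; the semi-local assembly (`exists_mem_cycIntLattice_eulerTwist_eq_of_forall`)
wants it at EVERY `𝔓 ∣ p`.  Seat w2-c4's weighted road moves bounds along `S = (σ_g)_{𝔓₀} : L_{𝔓₀} → L_𝔓`
(`σ_g • 𝔓₀ = 𝔓`; p531776).  Since `Gal(ℚ(ζ_m)/ℚ)` is abelian, `(σ_g)` INTERTWINES the local Euler operators: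

* `sigma_mul_comm` (`σ_g σ_w = σ_w σ_g`), ★ `galAdicCompletionMap_sigma_comm`
  (`(σ_g)_{𝔓₀→𝔓} ∘ (σ_w)_{𝔓₀} = (σ_w)_𝔓 ∘ (σ_g)_{𝔓₀→𝔓}`), `galAdicCompletionMap_eulerTwistLoc`
  (`(σ_g)(p·x − a·S₀x + S₀²x) = p·(σ_g x) − a·S₁(σ_g x) + S₁²(σ_g x)`), and ★★
  `exists_eq_eulerTwistLoc_transport`: **`p·x ∈ P_w^loc·𝒪_{𝔓₀} ⟹ p·(σ_g)_{𝔓₀→𝔓} x ∈ P_w^loc·𝒪_𝔓`** (and `_iff`,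
  transporting back along `σ_{g⁻¹}`).

References: J. W. S. Cassels, A. Fröhlich (1967) Ch. VII §1.1 [CasselsFrohlichANT1967]; L. C. Washington (1997)
Thm. 2.13 [Washington1997]; C.-H. Kim, *AJM* 148 (2026) §3.4.1 [Kim2022StructureSelmer].
-/

set_option autoImplicit false
-- the cell's Theorems namespace `Summit.BirchSwinnertonDyer.BirchSwinnertonDyer.…` repeats the summit name by design (D-0017)
set_option linter.dupNamespace false
-- `CyclotomicField m ℚ`'s two `ℚ`-algebra structures agree only up to unfolding (as in the sibling files)
set_option backward.isDefEq.respectTransparency false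

noncomputable section

open scoped Classical NumberField
open IsDedekindDomain NumberField
open Literature.NumberTheory.Automorphic Literature.NumberTheory.AdelicBaseChange
open Literature.NumberTheory.EllipticCurves.Kato2004.EulerSystemValues (sigma)

namespace Summit.BirchSwinnertonDyer.BirchSwinnertonDyer.Theorems.KimAtThreeCyclotomicSigmaTransport

variable (m : ℕ) [NeZero m] (p : ℕ) [hp : Fact p.Prime]

omit hp in
/-- `σ_g σ_w = σ_w σ_g` (`Gal(ℚ(ζ_m)/ℚ) ≅ (ℤ/m)ˣ` is abelian). [cite: Washington1997, Thm. 2.13] -/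
theorem sigma_mul_comm (g w : (ZMod m)ˣ) : sigma m g * sigma m w = sigma m w * sigma m g := by
  unfold sigma
  rw [← map_mul, ← map_mul, mul_comm]

/-- ★ **`(σ_g)_{𝔓₀→𝔓} ∘ (σ_w)_{𝔓₀} = (σ_w)_𝔓 ∘ (σ_g)_{𝔓₀→𝔓}`** on `ℚ(ζ_m)_{𝔓₀}`: the Galois transport between two
places above `p` intertwines the local operators induced by any `σ_w` stabilising both (cocycle law
`galAdicCompletionMap_galAdicCompletionMap` + commutativity). [cite: CasselsFrohlichANT1967, Ch. VII §1.1] -/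
theorem galAdicCompletionMap_sigma_comm (g w : (ZMod m)ˣ)
    {𝔓₀ 𝔓 : ((Rat.HeightOneSpectrum.primesEquiv (R := 𝓞 ℚ)).symm ⟨p, hp.out⟩).Extension (𝓞 (CyclotomicField m ℚ))}
    (hg : sigma m g • 𝔓₀.1 = 𝔓.1) (h₀ : sigma m w • 𝔓₀.1 = 𝔓₀.1) (h₁ : sigma m w • 𝔓.1 = 𝔓.1)
    (y : 𝔓₀.1.adicCompletion (CyclotomicField m ℚ)) :
    galAdicCompletionMap (sigma m g) hg (galAdicCompletionMap (sigma m w) h₀ y) =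
      galAdicCompletionMap (sigma m w) h₁ (galAdicCompletionMap (sigma m g) hg y) := by
  rw [galAdicCompletionMap_galAdicCompletionMap, galAdicCompletionMap_galAdicCompletionMap]
  exact galAdicCompletionMap_congr_left (CyclotomicField m ℚ) (sigma_mul_comm m g w) _ _ y

/-- **The Galois transport of the local Euler operator**: with `S₀ = (σ_w)_{𝔓₀}`, `S₁ = (σ_w)_𝔓`, `T = (σ_g)_{𝔓₀→𝔓}`:
`T(p·x − a·S₀ x + S₀(S₀ x)) = p·(T x) − a·S₁(T x) + S₁(S₁(T x))`. [cite: CasselsFrohlichANT1967, Ch. VII §1.1] -/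
theorem galAdicCompletionMap_eulerTwistLoc (g w : (ZMod m)ˣ) (a : ℤ)
    {𝔓₀ 𝔓 : ((Rat.HeightOneSpectrum.primesEquiv (R := 𝓞 ℚ)).symm ⟨p, hp.out⟩).Extension (𝓞 (CyclotomicField m ℚ))}
    (hg : sigma m g • 𝔓₀.1 = 𝔓.1) (h₀ : sigma m w • 𝔓₀.1 = 𝔓₀.1) (h₁ : sigma m w • 𝔓.1 = 𝔓.1)
    (x : 𝔓₀.1.adicCompletion (CyclotomicField m ℚ)) :
    galAdicCompletionMap (sigma m g) hg
        ((p : 𝔓₀.1.adicCompletion (CyclotomicField m ℚ)) * x -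
          (a : 𝔓₀.1.adicCompletion (CyclotomicField m ℚ)) * galAdicCompletionMap (sigma m w) h₀ x +
          galAdicCompletionMap (sigma m w) h₀ (galAdicCompletionMap (sigma m w) h₀ x)) =
      (p : 𝔓.1.adicCompletion (CyclotomicField m ℚ)) * galAdicCompletionMap (sigma m g) hg x -
        (a : 𝔓.1.adicCompletion (CyclotomicField m ℚ)) *
          galAdicCompletionMap (sigma m w) h₁ (galAdicCompletionMap (sigma m g) hg x) +
        galAdicCompletionMap (sigma m w) h₁
          (galAdicCompletionMap (sigma m w) h₁ (galAdicCompletionMap (sigma m g) hg x)) := by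
  rw [map_add, map_sub, map_mul, map_mul, map_natCast, map_intCast,
    galAdicCompletionMap_sigma_comm m p g w hg h₀ h₁, galAdicCompletionMap_sigma_comm m p g w hg h₀ h₁,
    galAdicCompletionMap_sigma_comm m p g w hg h₀ h₁]

/-- ★★ **Transport of the twisted membership `p·x ∈ P_w^loc·𝒪` from `𝔓₀` to `𝔓 = σ_g • 𝔓₀`**: if
`p·x = p·o − a·S₀ o + S₀(S₀ o)` with `o ∈ 𝒪_{𝔓₀}`, then `p·(T x) = p·o' − a·S₁ o' + S₁(S₁ o')` with
`o' = T o ∈ 𝒪_𝔓` (`T = (σ_g)_{𝔓₀→𝔓}` preserves integrality). [cite: Kim2022StructureSelmer, §3.4.1]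
[cite: CasselsFrohlichANT1967, Ch. VII §1.1] -/
theorem exists_eq_eulerTwistLoc_transport (g w : (ZMod m)ˣ) (a : ℤ)
    {𝔓₀ 𝔓 : ((Rat.HeightOneSpectrum.primesEquiv (R := 𝓞 ℚ)).symm ⟨p, hp.out⟩).Extension (𝓞 (CyclotomicField m ℚ))}
    (hg : sigma m g • 𝔓₀.1 = 𝔓.1) (h₀ : sigma m w • 𝔓₀.1 = 𝔓₀.1) (h₁ : sigma m w • 𝔓.1 = 𝔓.1)
    (x : 𝔓₀.1.adicCompletion (CyclotomicField m ℚ))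
    (hx : ∃ o ∈ 𝔓₀.1.adicCompletionIntegers (CyclotomicField m ℚ),
      (p : 𝔓₀.1.adicCompletion (CyclotomicField m ℚ)) * x =
        (p : 𝔓₀.1.adicCompletion (CyclotomicField m ℚ)) * o -
          (a : 𝔓₀.1.adicCompletion (CyclotomicField m ℚ)) * galAdicCompletionMap (sigma m w) h₀ o +
          galAdicCompletionMap (sigma m w) h₀ (galAdicCompletionMap (sigma m w) h₀ o)) :
    ∃ o' ∈ 𝔓.1.adicCompletionIntegers (CyclotomicField m ℚ),
      (p : 𝔓.1.adicCompletion (CyclotomicField m ℚ)) * galAdicCompletionMap (sigma m g) hg x =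
        (p : 𝔓.1.adicCompletion (CyclotomicField m ℚ)) * o' -
          (a : 𝔓.1.adicCompletion (CyclotomicField m ℚ)) * galAdicCompletionMap (sigma m w) h₁ o' +
          galAdicCompletionMap (sigma m w) h₁ (galAdicCompletionMap (sigma m w) h₁ o') := by
  obtain ⟨o, ho, hxo⟩ := hx
  refine ⟨galAdicCompletionMap (sigma m g) hg o,
    (galAdicCompletionMap_mem_adicCompletionIntegers_iff (CyclotomicField m ℚ) (sigma m g) hg o).mpr ho, ?_⟩
  rw [← galAdicCompletionMap_eulerTwistLoc m p g w a hg h₀ h₁ o, ← hxo, map_mul, map_natCast]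

/-- The same transport as an `iff` (back along `σ_{g⁻¹}`, `σ_g⁻¹ • 𝔓 = 𝔓₀`). [cite: CasselsFrohlichANT1967, Ch. VII §1.1] -/
theorem exists_eq_eulerTwistLoc_transport_iff (g w : (ZMod m)ˣ) (a : ℤ)
    {𝔓₀ 𝔓 : ((Rat.HeightOneSpectrum.primesEquiv (R := 𝓞 ℚ)).symm ⟨p, hp.out⟩).Extension (𝓞 (CyclotomicField m ℚ))}
    (hg : sigma m g • 𝔓₀.1 = 𝔓.1) (h₀ : sigma m w • 𝔓₀.1 = 𝔓₀.1) (h₁ : sigma m w • 𝔓.1 = 𝔓.1)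
    (x : 𝔓₀.1.adicCompletion (CyclotomicField m ℚ)) :
    (∃ o ∈ 𝔓₀.1.adicCompletionIntegers (CyclotomicField m ℚ),
      (p : 𝔓₀.1.adicCompletion (CyclotomicField m ℚ)) * x =
        (p : 𝔓₀.1.adicCompletion (CyclotomicField m ℚ)) * o -
          (a : 𝔓₀.1.adicCompletion (CyclotomicField m ℚ)) * galAdicCompletionMap (sigma m w) h₀ o +
          galAdicCompletionMap (sigma m w) h₀ (galAdicCompletionMap (sigma m w) h₀ o)) ↔
    ∃ o' ∈ 𝔓.1.adicCompletionIntegers (CyclotomicField m ℚ),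
      (p : 𝔓.1.adicCompletion (CyclotomicField m ℚ)) * galAdicCompletionMap (sigma m g) hg x =
        (p : 𝔓.1.adicCompletion (CyclotomicField m ℚ)) * o' -
          (a : 𝔓.1.adicCompletion (CyclotomicField m ℚ)) * galAdicCompletionMap (sigma m w) h₁ o' +
          galAdicCompletionMap (sigma m w) h₁ (galAdicCompletionMap (sigma m w) h₁ o') := by
  refine ⟨exists_eq_eulerTwistLoc_transport m p g w a hg h₀ h₁ x, fun h => ?_⟩
  have hg' : sigma m g⁻¹ • 𝔓.1 = 𝔓₀.1 := by
    have : sigma m g⁻¹ = (sigma m g)⁻¹ := by unfold sigma; rw [map_inv]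
    rw [this]
    exact inv_smul_eq_iff.mpr hg.symm
  have hback := exists_eq_eulerTwistLoc_transport m p g⁻¹ w a hg' h₁ h₀ _ h
  have hid : galAdicCompletionMap (sigma m g⁻¹) hg' (galAdicCompletionMap (sigma m g) hg x) = x := by
    have : sigma m g⁻¹ = (sigma m g)⁻¹ := by unfold sigma; rw [map_inv]
    rw [galAdicCompletionMap_congr_left (CyclotomicField m ℚ) this _
      (inv_smul_eq_iff.mpr hg.symm), galAdicCompletionMap_inv_apply]
  rwa [hid] at hback

end Summit.BirchSwinnertonDyer.BirchSwinnertonDyer.Theorems.KimAtThreeCyclotomicSigmaTransport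

end
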